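import Summits.QuantumFields.BalabanUV.Beta.PropagatorWoodburyFibre

/-!
# Beta / PropagatorWoodburyFibreReduction — Woodbury for the soft constraint, the certified SIZES of the fibre factors, the exact
COLOUR-fibre reduction, and the SCALAR fibre = King's `effSymbol` (King's Lemma 4.1 by name)

Cell `pub-balaban`, β sub-cell, BINDER ROW **G-an2-4 ∕ (CONV-C)**, prover part **P3 = WOODBURY-FIBRE reduction** (unit `b2b-balaban-gan24-p3`);
sibling and continuation of `PropagatorWoodburyFibre` (the objects `pivot`, `effForm`, `minimiser`, `flucCov`, `effFormSoft`, the KKT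
identity, the composition law and the deviation identities are there).  HONEST FRAMING (verbatim): discharging `BetaPertH` makes Bałaban's
UV stability UNCONDITIONAL — a real constructive-QFT result; it is NOT the continuum limit and NOT the Clay problem.  (CONV-C) is OPEN and
is NOT discharged here.  HONEST DEPENDENCY: continuum YM on T⁴ ⇐ BetaPertH ∧ nine spine estimates (0/9 proved); BetaPertH ⇐ (D1) ∧ (D4) ∧
CAP+tail; G-an2-4 gates asym, D1 and NE2/3/4.  ABSOLUTE RULE honoured: every declaration is `[folklore]` finite-dimensional linear algebra;
the `[cite: …]` tags LOCATE printed formulas whose SHAPE is reproduced, nothing printed is a hypothesis.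

WHAT IS PROVED.
* §3 WOODBURY (soft constraint `exp(−a/2‖QA − B‖²)`): `(H + Qᴴ(a·1)Q)⁻¹ = H⁻¹ − H⁻¹Qᴴ·(a⁻¹·1 + QH⁻¹Qᴴ)⁻¹·QH⁻¹` (Mathlib's
  `Matrix.add_mul_mul_inv_eq_sub`), the commutation `Δ_a·S = S·Δ_a = 1 − a⁻¹Δ_a`, and Bałaban's ∕ King's effective form
  `a·1 − a²·Q(H + aQᴴQ)⁻¹Qᴴ = Δ_a := (a⁻¹·1 + QH⁻¹Qᴴ)⁻¹` (`soft_effective_form`; King (4.5) [cite: King1986, (4.5) p.670]).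
* §6 POSITIVITY — the certified sizes of the fibre factors over any star-ordered field: `H ≻ 0 ⇒ pivot ⪰ 0`, `⇒ pivot ≻ 0` for
  injective `Qᴴ`, hence the standing unit hypotheses of the sibling DISCHARGED (`isUnit_pivot_of_posDef`, `isUnit_softPivot`),
  `effForm ≻ 0`, `Γ ⪰ 0` (`= Γᴴ H Γ`), `a⁻¹·1 + pivot ≻ 0`, `Δ_a ≻ 0`, and KING'S «`Δ^{(k)}, Δ̄^{(k)} ≤ a_k`» [cite: King1986, proof
  of Lemma 4.1 p.671] IN MATRIX FORM: `a·1 − Δ_a = Δ_aᴴ·S·Δ_a + (SΔ_a)ᴴ·(a·1)·(SΔ_a)` (`smul_one_sub_effFormSoft`) hence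
  `a·1 − Δ_a ⪰ 0` (`effFormSoft_le`).
* §7 COLOUR FIBRE: for `H ⊗ 1_c`, `Q ⊗ 1_c` all four objects are `(·) ⊗ 1_c` — the `𝔤 ⊗ 𝔤`-valued `U = 1` kernels of the
  non-abelian theory are `δ^{ab}` times the colourless ones (B12 (1.21) `Π^{ab}_{μν} = δ^{ab}Π_{μν}` [cite: Balaban1987RG1, (1.21) p.264],
  locator only): the non-abelian `U = 1` comparison reduces EXACTLY to the colourless one; ZERO fibre correction in colour.
* §8 SCALAR FIBRE = KING: one coarse component, aliases `ι`, `H = diag(A_i)`, `Q = (u_i)`: `pivot = Σ_i u_i² A_i⁻¹` and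
  `effFormSoft a = King1986.EffectiveLaplacianRate.effSymbol univ a (u²) A`; King's kernel theorem `abs_effSymbol_sub_le` (Lemma 4.1)
  therefore applies verbatim to the scalar fibre (`scalar_fibre_lemma41`) — the decl this route was asked to reduce to — and the
  sibling's `effFormSoft_sub` ∕ `effForm_sub` ∕ `flucCov_sub` are its matrix-fibre generalisation at the level of identities.

NOT GIVEN (located in `HOME/b2b-balaban-gan24-p3/WOODBURY-FIBRE.md`): the operator-NORM form of King's Lemma 4.1 for matrix fibres
(`‖Δ_a(H) − Δ_a(H′)‖ ≤ a²‖S(H′) − S(H)‖` from `effFormSoft_sub` + `effFormSoft_le`); any instantiation on the cell's `BlochFibreMatrix`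
system (gauge rows); position space; `U ≠ 1`.
v1.1 (append-only, same seat): §9 GAUGE-DEGENERATE FORMS — the situation of the cell's typed system (`d*d` is gauge-degenerate, the gauge is
fixed by extra constraint ROWS): for ANY regulariser `T` with `H_T := H + QᴴTQ` and its pivot invertible, the bordered inverse of the ORIGINAL
`[[H, Qᴴ],[Q, 0]]` is `[[Γ(H_T), ℋ(H_T)],[ℋ♭(H_T), T − Δ_eff(H_T)]]` (`inv_kkt_of_reg`); hence the fluctuation covariance, the minimiser and the
true multiplier block `Δ_eff(H_T) − T` of a form that is merely definite on `ker Q` are computed by §§2–5 of the sibling at `H_T` and do NOT depend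
on `T` (`flucCov_reg_indep`, `minimiser_reg_indep`, `effForm_sub_reg_indep`).  With `Q :=` (averaging rows stacked with gauge rows) this is exactly
how `H⁻¹` is to be read in R1–R3 of `HOME/b2b-balaban-gan24-p3/WOODBURY-FIBRE.md` for an2's `BlochFibreMatrix` system (census V2 (i) discharged;
(ii)–(iii) — the gauge rows do not factor through `Q_{Lc^j}` and depend on `j` — untouched).

-/

namespace Summit.QuantumFields.BalabanUV.Beta.PropagatorWoodburyFibre

open Matrix
open scoped Kronecker

section Soft

variable {𝕜 : Type*} [Field 𝕜] [StarRing 𝕜]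
variable {m n : Type*} [Fintype m] [Fintype n] [DecidableEq m] [DecidableEq n]


/-! ## §3 Woodbury: the soft constraint -/

omit [StarRing 𝕜] in
/-- `(a • 1)⁻¹ = a⁻¹ • 1` for `a ≠ 0`. [folklore] -/
theorem inv_smul_one {a : 𝕜} (ha : a ≠ 0) : (a • (1 : Matrix m m 𝕜))⁻¹ = a⁻¹ • (1 : Matrix m m 𝕜) :=
  inv_eq_right_inv (by rw [Matrix.smul_mul, Matrix.one_mul, smul_smul, mul_inv_cancel₀ ha, one_smul])

/-- **WOODBURY for the soft constraint**: `(H + a·QᴴQ)⁻¹ = H⁻¹ − H⁻¹Qᴴ (a⁻¹·1 + QH⁻¹Qᴴ)⁻¹ Q H⁻¹`. [folklore] -/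
theorem woodbury_soft {H : Matrix n n 𝕜} {Q : Matrix m n 𝕜} {a : 𝕜} (ha : a ≠ 0) (hH : IsUnit H)
    (hS : IsUnit (a⁻¹ • (1 : Matrix m m 𝕜) + pivot H Q)) :
    (H + Qᴴ * (a • (1 : Matrix m m 𝕜)) * Q)⁻¹ = H⁻¹ - H⁻¹ * Qᴴ * effFormSoft a H Q * Q * H⁻¹ := by
  have hC : IsUnit (a • (1 : Matrix m m 𝕜)) :=
    (Matrix.isUnit_iff_isUnit_det _).mpr (Matrix.isUnit_det_of_right_inverse
      (B := a⁻¹ • (1 : Matrix m m 𝕜)) (by rw [Matrix.smul_mul, Matrix.one_mul, smul_smul, mul_inv_cancel₀ ha, one_smul]))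
  have hAC : IsUnit ((a • (1 : Matrix m m 𝕜))⁻¹ + Q * H⁻¹ * Qᴴ) := by rwa [inv_smul_one ha]
  rw [Matrix.add_mul_mul_inv_eq_sub _ _ _ _ hH hC hAC, effFormSoft, pivot, inv_smul_one ha]

/-- The soft effective form commutes past the pivot: `(a⁻¹ + S)⁻¹ S = 1 − a⁻¹ (a⁻¹ + S)⁻¹`. [folklore] -/
theorem effFormSoft_mul_pivot {H : Matrix n n 𝕜} {Q : Matrix m n 𝕜} {a : 𝕜}
    (hS : IsUnit (a⁻¹ • (1 : Matrix m m 𝕜) + pivot H Q)) :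
    effFormSoft a H Q * pivot H Q = 1 - a⁻¹ • effFormSoft a H Q := by
  have hS' := (isUnit_iff_isUnit_det _).mp hS
  have h := nonsing_inv_mul _ hS'
  rw [Matrix.mul_add, Matrix.mul_smul, Matrix.mul_one] at h
  rw [effFormSoft, eq_sub_iff_add_eq, add_comm, h]

/-- … and `S (a⁻¹ + S)⁻¹ = 1 − a⁻¹ (a⁻¹ + S)⁻¹`. [folklore] -/
theorem pivot_mul_effFormSoft {H : Matrix n n 𝕜} {Q : Matrix m n 𝕜} {a : 𝕜}
    (hS : IsUnit (a⁻¹ • (1 : Matrix m m 𝕜) + pivot H Q)) :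
    pivot H Q * effFormSoft a H Q = 1 - a⁻¹ • effFormSoft a H Q := by
  have hS' := (isUnit_iff_isUnit_det _).mp hS
  have h := mul_nonsing_inv _ hS'
  rw [Matrix.add_mul, Matrix.smul_mul, Matrix.one_mul] at h
  rw [effFormSoft, eq_sub_iff_add_eq, add_comm, h]

/-- **The soft effective coarse form** (Bałaban's `Δ_k = a − a²·QGQ*` with `G = (H + aQᴴQ)⁻¹`; King's (4.5)):
`a·1 − a²·Q (H + a·QᴴQ)⁻¹ Qᴴ = (a⁻¹·1 + QH⁻¹Qᴴ)⁻¹`. [folklore] -/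
theorem soft_effective_form {H : Matrix n n 𝕜} {Q : Matrix m n 𝕜} {a : 𝕜} (ha : a ≠ 0) (hH : IsUnit H)
    (hS : IsUnit (a⁻¹ • (1 : Matrix m m 𝕜) + pivot H Q)) :
    a • (1 : Matrix m m 𝕜) - (a ^ 2) • (Q * (H + Qᴴ * (a • (1 : Matrix m m 𝕜)) * Q)⁻¹ * Qᴴ) = effFormSoft a H Q := by
  rw [woodbury_soft ha hH hS, Matrix.mul_sub, Matrix.sub_mul]
  have e1 : Q * H⁻¹ * Qᴴ = pivot H Q := rfl
  have e2 : Q * (H⁻¹ * Qᴴ * effFormSoft a H Q * Q * H⁻¹) * Qᴴ = pivot H Q * effFormSoft a H Q * pivot H Q := by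
    simp only [pivot, Matrix.mul_assoc]
  have e3 : pivot H Q * effFormSoft a H Q * pivot H Q =
      pivot H Q - a⁻¹ • (1 : Matrix m m 𝕜) + (a⁻¹ * a⁻¹) • effFormSoft a H Q := by
    rw [pivot_mul_effFormSoft hS, Matrix.sub_mul, Matrix.one_mul, Matrix.smul_mul, effFormSoft_mul_pivot hS, smul_sub,
      smul_smul]
    abel
  rw [e1, e2, e3]
  have ha2 : a ^ 2 * a⁻¹ = a := by rw [sq, mul_assoc, mul_inv_cancel₀ ha, mul_one]
  have ha3 : a ^ 2 * (a⁻¹ * a⁻¹) = 1 := by rw [← mul_assoc, ha2, mul_inv_cancel₀ ha]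
  simp only [smul_sub, smul_add, smul_smul, ha2, ha3, one_smul]
  abel

end Soft

section Colour

/-! ## §7 The colour fibre: exact reduction of the non-abelian `U = 1` kernels to the colourless ones -/

variable {𝕜 : Type*} [Field 𝕜] [StarRing 𝕜]
variable {m n c : Type*} [Fintype m] [Fintype n] [Fintype c] [DecidableEq m] [DecidableEq n] [DecidableEq c]

omit [StarRing 𝕜] [Fintype m] [Fintype n] [DecidableEq m] [DecidableEq n] in
/-- `(A − B) ⊗ C = A ⊗ C − B ⊗ C`. [folklore] -/
theorem sub_kronecker {p q : Type*} (A B : Matrix m n 𝕜) (C : Matrix p q 𝕜) :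
    (A - B) ⊗ₖ C = A ⊗ₖ C - B ⊗ₖ C := by
  ext ⟨i, j⟩ ⟨i', j'⟩
  simp [Matrix.kroneckerMap_apply, sub_mul]

omit [StarRing 𝕜] in
/-- `(H ⊗ 1)⁻¹ = H⁻¹ ⊗ 1`. [folklore] -/
theorem inv_kronecker_one (H : Matrix n n 𝕜) : (H ⊗ₖ (1 : Matrix c c 𝕜))⁻¹ = H⁻¹ ⊗ₖ (1 : Matrix c c 𝕜) := by
  rw [Matrix.inv_kronecker, inv_one]

omit [Fintype m] [DecidableEq m] in
/-- **Colour fibre, pivot**: `pivot (H ⊗ 1_c) (Q ⊗ 1_c) = pivot H Q ⊗ 1_c`. [folklore] -/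
theorem pivot_kronecker_one (H : Matrix n n 𝕜) (Q : Matrix m n 𝕜) :
    pivot (H ⊗ₖ (1 : Matrix c c 𝕜)) (Q ⊗ₖ (1 : Matrix c c 𝕜)) = pivot H Q ⊗ₖ (1 : Matrix c c 𝕜) := by
  rw [pivot, pivot, inv_kronecker_one, conjTranspose_kronecker, conjTranspose_one, ← mul_kronecker_mul,
    ← mul_kronecker_mul, Matrix.mul_one, Matrix.mul_one]

/-- **Colour fibre, effective form**: `Δ_eff(H ⊗ 1_c, Q ⊗ 1_c) = Δ_eff(H,Q) ⊗ 1_c`. [folklore] -/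
theorem effForm_kronecker_one (H : Matrix n n 𝕜) (Q : Matrix m n 𝕜) :
    effForm (H ⊗ₖ (1 : Matrix c c 𝕜)) (Q ⊗ₖ (1 : Matrix c c 𝕜)) = effForm H Q ⊗ₖ (1 : Matrix c c 𝕜) := by
  rw [effForm, pivot_kronecker_one, inv_kronecker_one, effForm]

/-- **Colour fibre, minimiser**: `ℋ(H ⊗ 1_c, Q ⊗ 1_c) = ℋ(H,Q) ⊗ 1_c`. [folklore] -/
theorem minimiser_kronecker_one (H : Matrix n n 𝕜) (Q : Matrix m n 𝕜) :
    minimiser (H ⊗ₖ (1 : Matrix c c 𝕜)) (Q ⊗ₖ (1 : Matrix c c 𝕜)) = minimiser H Q ⊗ₖ (1 : Matrix c c 𝕜) := by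
  rw [minimiser, minimiser, effForm_kronecker_one, inv_kronecker_one, conjTranspose_kronecker, conjTranspose_one,
    ← mul_kronecker_mul, ← mul_kronecker_mul, Matrix.mul_one, Matrix.mul_one]

/-- **Colour fibre, fluctuation covariance**: `Γ(H ⊗ 1_c, Q ⊗ 1_c) = Γ(H,Q) ⊗ 1_c` — the `𝔤 ⊗ 𝔤`-valued `U = 1` kernels are
`δ^{ab}` times the colourless ones (B12 (1.21), locator only); the non-abelian `U = 1` comparison IS the colourless one. [folklore] -/
theorem flucCov_kronecker_one (H : Matrix n n 𝕜) (Q : Matrix m n 𝕜) :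
    flucCov (H ⊗ₖ (1 : Matrix c c 𝕜)) (Q ⊗ₖ (1 : Matrix c c 𝕜)) = flucCov H Q ⊗ₖ (1 : Matrix c c 𝕜) := by
  rw [flucCov, flucCov, effForm_kronecker_one, inv_kronecker_one, conjTranspose_kronecker, conjTranspose_one,
    ← mul_kronecker_mul, ← mul_kronecker_mul, ← mul_kronecker_mul, ← mul_kronecker_mul, Matrix.mul_one, Matrix.mul_one,
    Matrix.mul_one, Matrix.mul_one, sub_kronecker]

end Colour

section Positivity

/-! ## §6 Positivity: the certified size of the fibre factors -/

variable {𝕜 : Type*} [Field 𝕜] [PartialOrder 𝕜] [StarRing 𝕜] [StarOrderedRing 𝕜]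
variable {m n : Type*} [Fintype m] [Fintype n] [DecidableEq m] [DecidableEq n]

omit [StarOrderedRing 𝕜] [DecidableEq m] in
/-- `H ≻ 0 ⇒ pivot ⪰ 0`. [folklore] -/
theorem pivot_posSemidef {H : Matrix n n 𝕜} (hH : H.PosDef) (Q : Matrix m n 𝕜) : (pivot H Q).PosSemidef :=
  hH.inv.posSemidef.mul_mul_conjTranspose_same Q

omit [StarOrderedRing 𝕜] [DecidableEq m] in
/-- `H ≻ 0` and `Qᴴ` injective (the constraint rows independent) `⇒ pivot ≻ 0`. [folklore] -/
theorem pivot_posDef {H : Matrix n n 𝕜} (hH : H.PosDef) {Q : Matrix m n 𝕜} (hQ : Function.Injective Q.vecMul) :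
    (pivot H Q).PosDef :=
  hH.inv.mul_mul_conjTranspose_same hQ

omit [StarOrderedRing 𝕜] in
/-- … hence the pivot is a unit (the standing hypothesis `hP` of §§2–5 discharged from positivity). [folklore] -/
theorem isUnit_pivot_of_posDef {H : Matrix n n 𝕜} (hH : H.PosDef) {Q : Matrix m n 𝕜} (hQ : Function.Injective Q.vecMul) :
    IsUnit (pivot H Q) :=
  (pivot_posDef hH hQ).isUnit

omit [StarOrderedRing 𝕜] in
/-- `Δ_eff ≻ 0`. [folklore] -/
theorem effForm_posDef {H : Matrix n n 𝕜} (hH : H.PosDef) {Q : Matrix m n 𝕜} (hQ : Function.Injective Q.vecMul) :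
    (effForm H Q).PosDef :=
  (pivot_posDef hH hQ).inv

omit [StarOrderedRing 𝕜] in
/-- `Γ ⪰ 0` (it is `Γᴴ H Γ`). [folklore] -/
theorem flucCov_posSemidef {H : Matrix n n 𝕜} (hH : H.PosDef) {Q : Matrix m n 𝕜} (hQ : Function.Injective Q.vecMul) :
    (flucCov H Q).PosSemidef := by
  have h := hH.posSemidef.conjTranspose_mul_mul_same (flucCov H Q)
  rwa [flucCov_conjTranspose hH.isHermitian, flucCov_mul_form_mul_flucCov hH.isUnit (isUnit_pivot_of_posDef hH hQ)] at h

/-- The soft pivot `a⁻¹·1 + Q H⁻¹ Qᴴ ≻ 0` for `a⁻¹ > 0` (no rank condition on `Q`). [folklore] -/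
theorem softPivot_posDef {H : Matrix n n 𝕜} (hH : H.PosDef) (Q : Matrix m n 𝕜) {a : 𝕜} (ha : 0 < a⁻¹) :
    (a⁻¹ • (1 : Matrix m m 𝕜) + pivot H Q).PosDef := by
  rw [Matrix.smul_one_eq_diagonal]
  exact (Matrix.PosDef.diagonal fun _ => ha).add_posSemidef (pivot_posSemidef hH Q)

/-- … hence a unit (the standing hypothesis `hS` of §3 discharged from positivity). [folklore] -/
theorem isUnit_softPivot {H : Matrix n n 𝕜} (hH : H.PosDef) (Q : Matrix m n 𝕜) {a : 𝕜} (ha : 0 < a⁻¹) :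
    IsUnit (a⁻¹ • (1 : Matrix m m 𝕜) + pivot H Q) :=
  (softPivot_posDef hH Q ha).isUnit

/-- The soft effective form `Δ_a ≻ 0`. [folklore] -/
theorem effFormSoft_posDef {H : Matrix n n 𝕜} (hH : H.PosDef) (Q : Matrix m n 𝕜) {a : 𝕜} (ha : 0 < a⁻¹) :
    (effFormSoft a H Q).PosDef :=
  (softPivot_posDef hH Q ha).inv

omit [PartialOrder 𝕜] [StarOrderedRing 𝕜] in
/-- **KING'S «`Δ̄ ≤ a`» IN MATRIX FORM — the identity**: `a·1 − Δ_a = (Δ_a S)·Δ_a + (Δ_a S)·(a·1)·(S Δ_a)` with `Δ_a S = S Δ_a = 1 − a⁻¹Δ_a`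
(pure algebra; [cite: King1986, proof of Lemma 4.1 p.671] for the scalar sentence). [folklore] -/
theorem smul_one_sub_effFormSoft {H : Matrix n n 𝕜} {Q : Matrix m n 𝕜} {a : 𝕜} (ha : a ≠ 0)
    (hS : IsUnit (a⁻¹ • (1 : Matrix m m 𝕜) + pivot H Q)) :
    a • (1 : Matrix m m 𝕜) - effFormSoft a H Q =
      effFormSoft a H Q * pivot H Q * effFormSoft a H Q +
        effFormSoft a H Q * pivot H Q * (a • (1 : Matrix m m 𝕜)) * (pivot H Q * effFormSoft a H Q) := by
  rw [effFormSoft_mul_pivot hS, pivot_mul_effFormSoft hS]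
  set E := effFormSoft a H Q
  have e1 : (1 - a⁻¹ • E) * E = E - a⁻¹ • (E * E) := by rw [Matrix.sub_mul, Matrix.one_mul, Matrix.smul_mul]
  have e2 : (1 - a⁻¹ • E) * (a • (1 : Matrix m m 𝕜)) = a • (1 : Matrix m m 𝕜) - E := by
    rw [Matrix.sub_mul, Matrix.one_mul, Matrix.smul_mul, Matrix.mul_smul, Matrix.mul_one, smul_smul, inv_mul_cancel₀ ha, one_smul]
  have e3 : (a • (1 : Matrix m m 𝕜) - E) * (1 - a⁻¹ • E) = a • (1 : Matrix m m 𝕜) - E - E + a⁻¹ • (E * E) := by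
    rw [Matrix.sub_mul, Matrix.mul_sub, Matrix.mul_sub, Matrix.mul_one, Matrix.mul_one, Matrix.smul_mul, Matrix.one_mul,
      Matrix.mul_smul, smul_smul, mul_inv_cancel₀ ha, one_smul]
    abel
  rw [e1, e2, e3]
  abel

/-- **KING'S «`Δ̄ ≤ a`» IN MATRIX FORM**: for `H ≻ 0` and `a, a⁻¹ > 0`, `a·1 − Δ_a ⪰ 0` — both summands of `smul_one_sub_effFormSoft` are
congruences of positive semidefinite matrices (`S ⪰ 0`, `a·1 ⪰ 0`).  This is the certified SIZE of the soft effective form on every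
fibre, the matrix replacement of the scalar step «`Δ̄^{(k)} ≤ a_k`» in (4.11). [folklore] -/
theorem effFormSoft_le {H : Matrix n n 𝕜} (hH : H.PosDef) (Q : Matrix m n 𝕜) {a : 𝕜} (ha : 0 < a) (hai : 0 < a⁻¹) :
    (a • (1 : Matrix m m 𝕜) - effFormSoft a H Q).PosSemidef := by
  have hS := isUnit_softPivot hH Q hai
  have hHh := hH.isHermitian
  have hEh : (effFormSoft a H Q)ᴴ = effFormSoft a H Q := by
    rw [effFormSoft, conjTranspose_nonsing_inv, conjTranspose_add, conjTranspose_smul, conjTranspose_one,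
      pivot_conjTranspose hHh, (IsSelfAdjoint.of_nonneg hai.le).star_eq]
  rw [smul_one_sub_effFormSoft ha.ne' hS]
  refine Matrix.PosSemidef.add ?_ ?_
  · have h := (pivot_posSemidef hH Q).conjTranspose_mul_mul_same (effFormSoft a H Q)
    rwa [hEh] at h
  · have h1 : (a • (1 : Matrix m m 𝕜)).PosSemidef := by
      rw [Matrix.smul_one_eq_diagonal]
      exact Matrix.PosSemidef.diagonal fun _ => ha.le
    have h := h1.conjTranspose_mul_mul_same (pivot H Q * effFormSoft a H Q)
    rwa [conjTranspose_mul, hEh, pivot_conjTranspose hHh] at h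

end Positivity

section Scalar

/-! ## §8 The scalar fibre IS King's `effSymbol` -/

open Literature.MathematicalPhysics.QuantumFieldTheory.King1986 (effSymbol abs_effSymbol_sub_le)

variable {ι : Type*} [Fintype ι] [DecidableEq ι]

/-- `(diag A)⁻¹ = diag(A⁻¹)` for nonvanishing `A`. [folklore] -/
theorem inv_diagonal_of_ne_zero {A : ι → ℝ} (hA : ∀ i, A i ≠ 0) :
    (Matrix.diagonal A)⁻¹ = Matrix.diagonal fun i => (A i)⁻¹ :=
  Matrix.inv_eq_right_inv (by
    rw [Matrix.diagonal_mul_diagonal, ← Matrix.diagonal_one]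
    congr 1
    funext i
    exact mul_inv_cancel₀ (hA i))

/-- One coarse component, aliases `ι`, `H = diag(A_i)`, `Q = (u_i)`: the pivot is King's alias sum `Σ_i u_i² A_i⁻¹`
(weights `w_i = u_i²`) [cite: King1986, (4.5) p.670]. [folklore] -/
theorem pivot_scalar (u : ι → ℝ) {A : ι → ℝ} (hA : ∀ i, A i ≠ 0) :
    pivot (Matrix.diagonal A) (Matrix.of fun (_ : Unit) i => u i) () () = ∑ i, u i ^ 2 * (A i)⁻¹ := by
  rw [pivot, inv_diagonal_of_ne_zero hA, Matrix.mul_apply]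
  refine Finset.sum_congr rfl fun j _ => ?_
  rw [Matrix.mul_diagonal, Matrix.conjTranspose_apply, Matrix.of_apply, star_trivial]
  ring

/-- **The scalar fibre IS King's (4.5)**: `effFormSoft a (diag A) (u) = (a⁻¹ + Σ_i u_i² A_i⁻¹)⁻¹ =
King1986.EffectiveLaplacianRate.effSymbol univ a (u²) A`. [folklore] -/
theorem effFormSoft_scalar (a : ℝ) (u : ι → ℝ) {A : ι → ℝ} (hA : ∀ i, A i ≠ 0) :
    effFormSoft a (Matrix.diagonal A) (Matrix.of fun (_ : Unit) i => u i) () () =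
      effSymbol Finset.univ a (fun i => u i ^ 2) A := by
  rw [effFormSoft, Matrix.inv_subsingleton, Matrix.diagonal_apply_eq, Ring.inverse_eq_inv, Matrix.add_apply,
    Matrix.smul_apply, Matrix.one_apply_eq, smul_eq_mul, mul_one, pivot_scalar u hA, effSymbol]

/-- **KING'S LEMMA 4.1 ON THE SCALAR FIBRE, BY NAME** (`King1986.EffectiveLaplacianRate.abs_effSymbol_sub_le` — the kernel
theorem the coordinator asked this route to reduce to): two scalar fibres with the same averaging weights `u` (`Σ u² ≤ 1`,
King's Parseval hypothesis) and alias values `A`, `D` that are `θ`-close inverse-wise satisfy `|Δ_a(A) − Δ_a(D)| ≤ a·θ·Δ_a(A)`.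
§5 `effFormSoft_sub` is the matrix-fibre generalisation of the IDENTITY behind it; the matrix-fibre INEQUALITY needs the
positivity of §6 in place of «`Δ̄ ≤ a`». [folklore] -/
theorem scalar_fibre_lemma41 {a θ : ℝ} (ha : 0 < a) (u : ι → ℝ) {A D : ι → ℝ} (hw1 : ∑ i, u i ^ 2 ≤ 1)
    (hA : ∀ i, 0 < A i) (hD : ∀ i, 0 < D i) (hθ : 0 ≤ θ) (hAD : ∀ i, |(A i)⁻¹ - (D i)⁻¹| ≤ θ) :
    |effFormSoft a (Matrix.diagonal A) (Matrix.of fun (_ : Unit) i => u i) () () -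
        effFormSoft a (Matrix.diagonal D) (Matrix.of fun (_ : Unit) i => u i) () ()| ≤
      a * θ * effFormSoft a (Matrix.diagonal A) (Matrix.of fun (_ : Unit) i => u i) () () := by
  rw [effFormSoft_scalar a u fun i => (hA i).ne', effFormSoft_scalar a u fun i => (hD i).ne']
  exact abs_effSymbol_sub_le ha (fun i _ => sq_nonneg (u i)) hw1 (fun i _ => hA i) (fun i _ => hD i) hθ
    fun i _ => hAD i

end Scalar

section Degenerate

/-! ## §9 Gauge-degenerate forms: the bordered inverse through ANY regularisation `H + QᴴTQ` (v1.1) -/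

variable {𝕜 : Type*} [Field 𝕜] [StarRing 𝕜]
variable {m n : Type*} [Fintype m] [Fintype n] [DecidableEq m] [DecidableEq n]

/-- **KKT for a form that is only definite on `ker Q`**: if `H_T := H + QᴴTQ` and its pivot are units (e.g. `H ⪰ 0`, `H ≻ 0` on `ker Q`,
`T = 1`), then `[[H, Qᴴ],[Q, 0]] · [[Γ(H_T), ℋ(H_T)],[ℋ♭(H_T), T − Δ_eff(H_T)]] = 1` — the regulariser only shifts the multiplier block.
[folklore] -/
theorem kkt_mul_blocks_of_reg {H : Matrix n n 𝕜} {Q : Matrix m n 𝕜} (T : Matrix m m 𝕜) (hHT : IsUnit (H + Qᴴ * T * Q))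
    (hP : IsUnit (pivot (H + Qᴴ * T * Q) Q)) :
    kkt H Q * fromBlocks (flucCov (H + Qᴴ * T * Q) Q) (minimiser (H + Qᴴ * T * Q) Q) (comultiplier (H + Qᴴ * T * Q) Q)
      (T - effForm (H + Qᴴ * T * Q) Q) = 1 := by
  set HT := H + Qᴴ * T * Q with hHTdef
  have hH : H = HT - Qᴴ * T * Q := by rw [hHTdef]; abel
  have hHT' := (isUnit_iff_isUnit_det _).mp hHT
  rw [kkt, hH, fromBlocks_multiply, ← fromBlocks_one, fromBlocks_inj]
  refine ⟨?_, ?_, ?_, ?_⟩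
  · rw [Matrix.sub_mul, form_mul_flucCov hHT, Matrix.mul_assoc (Qᴴ * T) Q, constraint_mul_flucCov hP, Matrix.mul_zero, sub_zero,
      sub_add_cancel]
  · have h1 : HT * minimiser HT Q = (HT * HT⁻¹) * (Qᴴ * effForm HT Q) := by simp only [minimiser, Matrix.mul_assoc]
    rw [Matrix.sub_mul, h1, mul_nonsing_inv _ hHT', Matrix.one_mul, Matrix.mul_assoc (Qᴴ * T) Q, constraint_mul_minimiser hP,
      Matrix.mul_one, Matrix.mul_sub]
    abel
  · rw [constraint_mul_flucCov hP, Matrix.zero_mul, add_zero]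
  · rw [constraint_mul_minimiser hP, Matrix.zero_mul, add_zero]

/-- **The bordered inverse of a gauge-degenerate form** (any admissible regulariser `T`). [folklore] -/
theorem inv_kkt_of_reg {H : Matrix n n 𝕜} {Q : Matrix m n 𝕜} (T : Matrix m m 𝕜) (hHT : IsUnit (H + Qᴴ * T * Q))
    (hP : IsUnit (pivot (H + Qᴴ * T * Q) Q)) :
    (kkt H Q)⁻¹ = fromBlocks (flucCov (H + Qᴴ * T * Q) Q) (minimiser (H + Qᴴ * T * Q) Q) (comultiplier (H + Qᴴ * T * Q) Q)
      (T - effForm (H + Qᴴ * T * Q) Q) :=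
  inv_eq_right_inv (kkt_mul_blocks_of_reg T hHT hP)

/-- … and the bordered matrix is then a unit. [folklore] -/
theorem isUnit_kkt_of_reg {H : Matrix n n 𝕜} {Q : Matrix m n 𝕜} (T : Matrix m m 𝕜) (hHT : IsUnit (H + Qᴴ * T * Q))
    (hP : IsUnit (pivot (H + Qᴴ * T * Q) Q)) : IsUnit (kkt H Q) :=
  (Matrix.isUnit_iff_isUnit_det _).mpr (Matrix.isUnit_det_of_right_inverse (kkt_mul_blocks_of_reg T hHT hP))

/-- **Regularisation independence of the fluctuation covariance**: `Γ(H + QᴴTQ, Q) = Γ(H + QᴴT′Q, Q)` for any two admissible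
regularisers — it is a block of the SAME bordered inverse. [folklore] -/
theorem flucCov_reg_indep {H : Matrix n n 𝕜} {Q : Matrix m n 𝕜} (T T' : Matrix m m 𝕜) (hHT : IsUnit (H + Qᴴ * T * Q))
    (hP : IsUnit (pivot (H + Qᴴ * T * Q) Q)) (hHT' : IsUnit (H + Qᴴ * T' * Q)) (hP' : IsUnit (pivot (H + Qᴴ * T' * Q) Q)) :
    flucCov (H + Qᴴ * T * Q) Q = flucCov (H + Qᴴ * T' * Q) Q := by
  have h := inv_kkt_of_reg T hHT hP
  rw [inv_kkt_of_reg T' hHT' hP', fromBlocks_inj] at h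
  exact h.1.symm

/-- **Regularisation independence of the minimiser**. [folklore] -/
theorem minimiser_reg_indep {H : Matrix n n 𝕜} {Q : Matrix m n 𝕜} (T T' : Matrix m m 𝕜) (hHT : IsUnit (H + Qᴴ * T * Q))
    (hP : IsUnit (pivot (H + Qᴴ * T * Q) Q)) (hHT' : IsUnit (H + Qᴴ * T' * Q)) (hP' : IsUnit (pivot (H + Qᴴ * T' * Q) Q)) :
    minimiser (H + Qᴴ * T * Q) Q = minimiser (H + Qᴴ * T' * Q) Q := by
  have h := inv_kkt_of_reg T hHT hP
  rw [inv_kkt_of_reg T' hHT' hP', fromBlocks_inj] at h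
  exact h.2.1.symm

/-- **The true multiplier block** `Δ_eff(H + QᴴTQ) − T` does not depend on `T` (it is minus the `(2,2)` block of the bordered inverse; for
`H ≻ 0` and `T = 0` it is `Δ_eff(H)` itself). [folklore] -/
theorem effForm_sub_reg_indep {H : Matrix n n 𝕜} {Q : Matrix m n 𝕜} (T T' : Matrix m m 𝕜) (hHT : IsUnit (H + Qᴴ * T * Q))
    (hP : IsUnit (pivot (H + Qᴴ * T * Q) Q)) (hHT' : IsUnit (H + Qᴴ * T' * Q)) (hP' : IsUnit (pivot (H + Qᴴ * T' * Q) Q)) :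
    effForm (H + Qᴴ * T * Q) Q - T = effForm (H + Qᴴ * T' * Q) Q - T' := by
  have h := inv_kkt_of_reg T hHT hP
  rw [inv_kkt_of_reg T' hHT' hP', fromBlocks_inj] at h
  have h5 : -(T' - effForm (H + Qᴴ * T' * Q) Q) = -(T - effForm (H + Qᴴ * T * Q) Q) := congrArg Neg.neg h.2.2.2
  rw [neg_sub, neg_sub] at h5
  exact h5.symm

end Degenerate

end Summit.QuantumFields.BalabanUV.Beta.PropagatorWoodburyFibre
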